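import Summits.HodgeConjecture.HodgeConjecture.Theorems.F0P6aModuliDatumLetters
import HarnessLib

/-!
# `F0P6aModuliDatumLayersApi` — ★ API of the GLUE `pwcore_of_up_galq` of `Theorems/F0P6aModuliDatumLayers.lean` (HEAD-ROOM CURE (γ); LEAD F0P6-plan «M-151a» (4); desk F0P6a-plan (g8))

Imports (bare lines; provenance here): `Theorems.F0P6aModuliDatumLetters` = ★ PART 1 of the MAIN re-home (the letter UP `RecordModuliPointwiseCoreUpstairsCofinal` and the
upstairs datum `PointwiseFrobeniusDatumUpstairsAt`; through it ★ `Theorems.F0D9opRoad2Mod` = the downstairs datum `PointwiseFrobeniusDatumAt`) · `HarnessLib`.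

WHAT.  THREE sorry-free THEOREMS (no `def`, no `instance`, no notation), declared in the namespace of ★ `Theorems/F0P6aModuliDatumLayers.lean` so that its glue cites
them by short name:
* §1 (generic, any number field `K`, place `v`, proper models `𝒳`, `𝒴`): `geomReductionMap_eq_map_geomReductionMap_section` — the reduction map of `𝒴` READ THROUGH
  a model morphism `𝔣 : 𝒳 ⟶ 𝒴` with generic fibre `f` and a pointwise section `ℓ` of `f`: `red_𝒴 P = 𝔣_v (red_𝒳 (ℓ P))` (★ `IntegralModel.geomReductionMap_map`,
  [SerreTate1968] §1); `map_specialFibre_map_aut_of_comp_eq` — a model morphism invariant under an automorphism `θ(a)` of its source (`θ(a) ≫ 𝔣 = 𝔣`) is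
  invariant on `κ̄(v)`-points of the special fibres: `𝔣_v (θ(a)_v p) = 𝔣_v p` (functoriality of ★ `specialFibreFunctor v`).  (The third reading of the glue,
  `𝔣_v ∘ F̃ = F̃ ∘ 𝔣_v`, is ALREADY ★: `Literature…IntegralModel.map_specialFibre_map_frobeniusOver`, cited by name — not restated.)
* §2 (at the letters՚ arity): `pointwiseFrobeniusDatumAt_of_upstairs` — the pointwise Frobenius datum UPSTAIRS MODULO `Γ` on a smooth proper model `𝓨` of `Y → M⋆_{Kc}`
  DESCENDS to the datum DOWNSTAIRS on a smooth proper model `𝒮c` of `M⋆_{Kc}` along a `Γ`-invariant model morphism `πq : 𝓨 ⟶ 𝒮c` with generic fibre `π` and a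
  pointwise section `ℓ` of `π` ([Liu2021] Prop. D.8 (3) p. 135 is the printed home of the pointwise datum; the transport is [SerreTate1968] §1 functoriality).
  This is, token for token, the BODY of GLUE `pwcore_of_up_galq : UP → GALQ → PWcore` after its `∃`-plumbing.

WHY (HEAD-ROOM CURE (γ), «M-151a» (4)).  ★ `pwcore_of_up_galq` (p853611) elaborates at 365 325 – 371 172 heartbeat-k-units of its declared 400 000 (LA2-p02 (g6) profile
`F0/P6/L2/LA2-p02/g6/hbpw/`; desk re-measure `F0/P6/F0P6a-plan/g8` NOTES): 91–93 % of budget, i.e. one Mathlib bump from RED.  The cost is not the three readings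
but the `intro`∕`obtain`∕anonymous-constructor plumbing over the 27-binder UP witness and the 8-binder GALQ witness elaborated together with them in ONE
declaration.  With the readings stated once here and the transport proved once at the letters՚ arity (16 394 heartbeats), the glue re-proves by `Exists.elim`
chains + one call of §2 at 15 239 heartbeats (3.8 % of 400 000; `#count_heartbeats` under `Elab.async false`).  Statement bytes of the glue do not move.
HC_CM is proved only modulo the 7 printed citations (2 remaining named inputs: hLiu418 = stmt-HodgeConjecture-24832, h413 = stmt-HodgeConjecture-24833) until rung 0
closes; an API file is count-neutral. -/

namespace Summit.HodgeConjecture.HodgeConjecture.Cruxes.HLiu418.F0P6aModuliDatum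
set_option linter.dupNamespace false  -- `Summit.HodgeConjecture.HodgeConjecture.…` BY DESIGN (D-0017), as in ★ `Theorems/F0P6aModuliDatumLayers.lean`
open CategoryTheory NumberField IsDedekindDomain MulAction
open scoped Matrix
open Literature.NumberTheory.GaloisRepresentations
open Literature.NumberTheory.Automorphic Literature.NumberTheory.Automorphic.UnitaryGroup
open Literature.AlgebraicGeometry.ShimuraVarieties.UnitaryCanonicalModel
open Literature.NumberTheory.Automorphic.Liu2021.AppendixC
open Literature.AlgebraicGeometry.Motives (AlgPoints IntegralModel frobeniusOver SchemeOver)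
open Literature.NumberTheory.DiophantineGeometry (geomResidueField specialFibreFunctor)
open Literature.AlgebraicGeometry.RelativeSpec (ActionOver)
open Literature.NumberTheory.EllipticCurves (genericFibre)
open Summit.HodgeConjecture.HodgeConjecture.Cruxes.HLiu418.F0D9opRoad2 (PointwiseFrobeniusDatumAt)


/-! ### §1 Generic readings — a model morphism with a pointwise section (`hred`) and an invariant model morphism (`hinv`) on special points -/

section LayersApi

open IsDedekindDomain.HeightOneSpectrum (valuationSubringAtPrime)

variable {K : Type} [Field K] [NumberField K] {v : HeightOneSpectrum (𝓞 K)} {X Y : SchemeOver K}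

/-- **API `hred` — the reduction map downstairs READ THROUGH a model morphism and a pointwise section** ([SerreTate1968] §1, naturality of
the reduction map, ★ `IntegralModel.geomReductionMap_map`): for proper models `𝒳` of `X`, `𝒴` of `Y` at `v`, a model morphism `𝔣 : 𝒳 ⟶ 𝒴` with
generic fibre `f : X ⟶ Y` and a set-theoretic section `ℓ` of `f` on `Ω`-points, `red_𝒴 P = 𝔣_v (red_𝒳 (ℓ P))`. [cite: SerreTate1968, §1] -/
theorem geomReductionMap_eq_map_geomReductionMap_section
    (𝒳 : IntegralModel (valuationSubringAtPrime K v) K X) (𝒴 : IntegralModel (valuationSubringAtPrime K v) K Y)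
    [AlgebraicGeometry.IsProper 𝒳.total.hom] [AlgebraicGeometry.IsProper 𝒴.total.hom] (𝔣 : 𝒳.total ⟶ 𝒴.total) (f : X ⟶ Y)
    (hf : (genericFibre (valuationSubringAtPrime K v) K).map 𝔣 ≫ 𝒴.genericIso'.hom = 𝒳.genericIso'.hom ≫ f)
    (ℓ : AlgPoints Y (AlgebraicClosure (v.adicCompletion K)) → AlgPoints X (AlgebraicClosure (v.adicCompletion K)))
    (hℓ : ∀ P, AlgPoints.map f (ℓ P) = P) (P : AlgPoints Y (AlgebraicClosure (v.adicCompletion K))) :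
    𝒴.geomReductionMap P = AlgPoints.map ((specialFibreFunctor v).map 𝔣 : 𝒳.reductionAt ⟶ 𝒴.reductionAt) (𝒳.geomReductionMap (ℓ P)) := by
  conv_lhs => rw [← hℓ P]
  exact IntegralModel.geomReductionMap_map 𝒳 𝒴 𝔣 f hf (ℓ P)

/-- **API `hinv` — a model morphism INVARIANT under an automorphism of the source stays invariant on special points**: if `θ(a) ≫ 𝔣 = 𝔣` on total
spaces then `𝔣_v (θ(a)_v p) = 𝔣_v p` on `κ̄(v)`-points (functoriality of ★ `specialFibreFunctor v`, ★ `AlgPoints.map_comp_apply`). [cite: SGA1, Exp. V §1] -/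
theorem map_specialFibre_map_aut_of_comp_eq
    (𝒳 : IntegralModel (valuationSubringAtPrime K v) K X) (𝒴 : IntegralModel (valuationSubringAtPrime K v) K Y)
    (𝔣 : 𝒳.total ⟶ 𝒴.total) {H : Type*} [Group H] (θ : ActionOver 𝒳.total.hom H) (a : H) (ha : (θ.aut a).hom ≫ 𝔣.left = 𝔣.left)
    (p : AlgPoints 𝒳.reductionAt (geomResidueField v)) :
    AlgPoints.map ((specialFibreFunctor v).map 𝔣 : 𝒳.reductionAt ⟶ 𝒴.reductionAt)
        (AlgPoints.map ((specialFibreFunctor v).map (Over.isoMk (θ.aut a) (θ.aut_comp a)).hom : 𝒳.reductionAt ⟶ 𝒳.reductionAt) p)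
      = AlgPoints.map ((specialFibreFunctor v).map 𝔣 : 𝒳.reductionAt ⟶ 𝒴.reductionAt) p := by
  have h1 : (Over.isoMk (θ.aut a) (θ.aut_comp a)).hom ≫ 𝔣 = 𝔣 :=
    Over.OverMorphism.ext (by change (θ.aut a).hom ≫ 𝔣.left = 𝔣.left; exact ha)
  rw [← AlgPoints.map_comp_apply, ← Functor.map_comp, h1]

end LayersApi

/-! ### §2 The transport of the pointwise Frobenius datum along a `Γ`-invariant model morphism (the body of GLUE `pwcore_of_up_galq`) -/

/-- **API TRANSPORT — the pointwise Frobenius datum DESCENDS along a `Γ`-invariant model morphism with a section** (the body of GLUE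
`pwcore_of_up_galq` after its ∃-plumbing, BY NAME): at a record datum, a split place `w`, the level `Kc`, a smooth proper model `𝓨` of an
`F`-scheme `Y` over `M⋆_{Kc}` (`π : Y → M⋆_{Kc}`, pointwise section `ℓ`) with an action `θ` of `Γ × G`, and a smooth proper model `𝒮c` of `M⋆_{Kc}`
with a model morphism `πq : 𝓨 ⟶ 𝒮c` that is `Γ`-INVARIANT (`θ(γ, 1) ≫ πq = πq`) with generic fibre `π`: the datum UPSTAIRS MODULO `Γ`
(`PointwiseFrobeniusDatumUpstairsAt … Y 𝓨 h𝓨 Γ G θ ℓ`) gives the datum DOWNSTAIRS (`PointwiseFrobeniusDatumAt … 𝒮c h𝒮c`) — read it in the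
`Γ`-invariant, Frobenius-compatible reading `(P, mk, Fr) := (𝒮c_s(κ̄(w)), πq_s, F̃)` (★ `IntegralModel.map_specialFibre_map_frobeniusOver`,
API `hinv`) and rewrite every reduced point `red_{𝒮c} Q = πq_s (red_𝓨 (ℓ Q))` (API `hred`). [cite: SerreTate1968, §1] [cite: Liu2021, Prop. D.8 (3) p. 135] -/
theorem pointwiseFrobeniusDatumAt_of_upstairs
    {F : Type} [Field F] [NumberField F] [IsCMField F] (ι₁ : F →+* ℂ)
    (Jstar : Matrix (Fin 2) (Fin 2) F)
    (K₀ : C5.OpenCompactSubgroup ↥(finAdelic ↥(maximalRealSubfield F) F (IsCMField.complexConj F) 2 Jstar))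
    (S : RecordSystemGS F Jstar ι₁ K₀) (hU7ₛ : S.HeckeTranslateDefinedOver)
    (hJ : (Jstar.map (IsCMField.complexConj F))ᵀ = Jstar) (hJu : IsUnit Jstar)
    (w : HeightOneSpectrum (𝓞 F)) (hw : (IsCMField.complexConj F) • w ≠ w)
    (Kc : C5.SmallLevel K₀) {Y : SchemeOver F} (π : Y ⟶ S.M.obj Kc)
    {Γ G : Type} [Group Γ] [Group G]
    (𝓨 : IntegralModel (HeightOneSpectrum.valuationSubringAtPrime F w) F Y) (h𝓨 : 𝓨.IsSmoothProper 1)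
    (θ : ActionOver 𝓨.total.hom (Γ × G))
    (ℓ : AlgPoints (S.M.obj Kc) (AlgebraicClosure (w.adicCompletion F)) → AlgPoints Y (AlgebraicClosure (w.adicCompletion F)))
    (hℓ : ∀ P, AlgPoints.map π (ℓ P) = P)
    (𝒮c : IntegralModel (HeightOneSpectrum.valuationSubringAtPrime F w) F (S.M.obj Kc)) (h𝒮c : 𝒮c.IsSmoothProper 1)
    (πq : 𝓨.total ⟶ 𝒮c.total) (hπqΓ : ∀ γ : Γ, (θ.aut (γ, 1)).hom ≫ πq.left = πq.left)
    (hπq : (genericFibre (HeightOneSpectrum.valuationSubringAtPrime F w) F).map πq ≫ 𝒮c.genericIso'.hom = 𝓨.genericIso'.hom ≫ π)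
    (hγ : PointwiseFrobeniusDatumUpstairsAt F ι₁ Jstar K₀ S hU7ₛ hJ hJu w hw Kc Y 𝓨 h𝓨 Γ G θ ℓ) :
    PointwiseFrobeniusDatumAt F ι₁ Jstar K₀ S hU7ₛ hJ hJu w hw Kc 𝒮c h𝒮c := by
  haveI : AlgebraicGeometry.IsProper 𝓨.total.hom := h𝓨.2
  haveI : AlgebraicGeometry.IsProper 𝒮c.total.hom := h𝒮c.2
  intro N' hN'Kc rc₁ hrc₁ hrcN₁ rc₂ hrc₂ hrcN₂ x'
  have key := hγ (AlgPoints 𝒮c.reductionAt (geomResidueField w))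
    (AlgPoints.map ((specialFibreFunctor w).map πq : 𝓨.reductionAt ⟶ 𝒮c.reductionAt))
    (AlgPoints.map (frobeniusOver 𝒮c.reductionAt)) (IntegralModel.map_specialFibre_map_frobeniusOver 𝓨 𝒮c πq)
    (fun γ p => map_specialFibre_map_aut_of_comp_eq 𝓨 𝒮c πq θ (γ, 1) (hπqΓ γ) p) N' hN'Kc rc₁ hrc₁ hrcN₁ rc₂ hrc₂ hrcN₂ x'
  simp only [geomReductionMap_eq_map_geomReductionMap_section 𝓨 𝒮c πq π hπq ℓ hℓ]
  exact key

end Summit.HodgeConjecture.HodgeConjecture.Cruxes.HLiu418.F0P6aModuliDatum
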